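import Literature.NumberTheory.EllipticCurves.PeriodIndexSupport
import Summits.BirchSwinnertonDyer.Rank1Residual.GaloisImage.SelmerGroupFinite
import HarnessLib

/-!
# A finite discrete Galois module is unramified outside a finite set of places (Serre, *Abelian ℓ-adic
# representations*, I §2.1) — the `S₀` every `∀`-module Poitou–Tate clause needs

Crux K4 `SignedControlAtTwo` (stmt-BirchSwinnertonDyer-20309; routes `ThetaPartnerAtTwo` / `ResidualThetaTransportAtTwo`), line
`eulerchar` v12, lead `bsd-wall-tp2-p3` g4 (`--supports stmt-BirchSwinnertonDyer-20309`, helper).  The registered stub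
`stub_poitouTateShaRat : poitouTate_sha_tateDual ℚ` quantifies over ALL finite discrete `n`-torsion `Γ_ℚ`-modules `M`
with no ramification set given, whereas every consumer-side theorem of the tree (`…MuRealShaDualCanonical`,
`PoitouTateShaAnnihilator.*`, the Selmer-structure counts) takes a finite `S₀ ⊇ {v ∣ ∞} ∪ {v ∣ n} ∪ Ram(M)` as a
hypothesis.  This file supplies `S₀` for every finite discrete module (the tree had it for framed representations,
`FramedGaloisRep.eventually_isUnramifiedAt_of_isOpen_ker`, and for Artin representations, `ArtinRep.isUnramifiedAE`):

* (tree input `Literature.NumberTheory.EllipticCurves.eventually_forall_inertia_le`: an OPEN normal subgroup `N ≤ Γ_F`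
  contains the inertia groups `I_𝔓 ≤ Γ_F` at all but finitely many finite places — the places below the different of
  `F̄^N / F` are finitely many and at the others `e = 1`);
* `isUnramifiedAE_of_isOpen_setOf_apply_eq_one` — a Galois representation `ρ : Γ_K → Aut_A(M)` with `{g | ρ g = 1}` open
  is unramified almost everywhere (`GaloisRep.IsUnramifiedAE`);
* **`isUnramifiedAE_of_finite`** — every FINITE discrete `Γ_K`-module is unramified almost everywhere
  (`SelmerFinite.isOpen_setOf_apply_eq_one`);
* **`exists_finset_place_isUnramifiedAt`** — the `Finset (Place K)` form used by the Poitou–Tate files: for a finite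
  discrete module `M` and `n ≥ 1` there is a finite `S₀ ∋` all infinite places with `v ∤ n` and `M` unramified at `v`
  for every finite `v ∉ S₀`.

THEOREMS ONLY (no definition, no named fact, no `sorry`); closes no item; BSD is not proved by any of this.
References: [SerreAbelianLadic1968] Ch. I §2.1; [NeukirchANT1999] Ch. III §2, Thm. (2.6) (primes ramified in `L/F`
divide the different); [MilneADT2006] I §4 (the set `S` of Thm. 4.10).
-/

noncomputable section

open Function NumberField IsDedekindDomain Field IntermediateField
open scoped NumberField Pointwise

universe u

set_option linter.dupNamespace false
set_option autoImplicit false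

namespace Summit.BirchSwinnertonDyer.BirchSwinnertonDyer.Theorems.SignedEC.MuReal

open Literature.NumberTheory.GaloisRepresentations Literature.NumberTheory

/-! ## Galois representations with open kernel; finite discrete modules -/

section Representations

variable {K : Type u} [Field K] [NumberField K] {A : Type*} [CommRing A] [TopologicalSpace A]
  {M : Type*} [AddCommGroup M] [Module A M] [TopologicalSpace M]

/-- **A Galois representation whose kernel `{g | ρ g = 1}` is open is unramified almost everywhere** (Serre I §2.1):
apply `eventually_inertia_le_of_isOpen` to the kernel. [cite: SerreAbelianLadic1968, Ch. I §2.1] -/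
theorem isUnramifiedAE_of_isOpen_setOf_apply_eq_one (ρ : GaloisRep K A M)
    (hopen : IsOpen {g : absoluteGaloisGroup K | ρ g = 1}) : ρ.IsUnramifiedAE := by
  have hker : ({g : absoluteGaloisGroup K | ρ g = 1} : Set (absoluteGaloisGroup K)) = (ρ.ker : Set _) := by
    ext g
    rw [Set.mem_setOf_eq, SetLike.mem_coe, ContinuousRep.mem_ker, Module.End.one_eq_id]
  haveI : ρ.ker.Normal := MonoidHom.normal_ker _
  have hev := Literature.NumberTheory.EllipticCurves.eventually_forall_inertia_le (F := K) ρ.ker (hker ▸ hopen)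
  rw [Filter.eventually_cofinite] at hev
  refine ⟨_, hev, fun v hv => ?_⟩
  simp only [Set.mem_setOf_eq, not_not] at hv
  intro 𝔓 h𝔓 σ hσ
  have hmem : σ ∈ ρ.ker := hv 𝔓 h𝔓 hσ
  rw [ContinuousRep.mem_ker] at hmem
  exact hmem.trans Module.End.one_eq_id.symm

end Representations

section Discrete

variable {K : Type u} [Field K] [NumberField K] {M : Type u} [AddCommGroup M] [TopologicalSpace M]
  [DiscreteTopology M]

/-- **Every finite discrete `Γ_K`-module is unramified almost everywhere** (its kernel is open:
`SelmerFinite.isOpen_setOf_apply_eq_one`). [cite: SerreAbelianLadic1968, Ch. I §2.1] -/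
theorem isUnramifiedAE_of_finite [Finite M] (ρ : DiscreteGaloisModule K M) : GaloisRep.IsUnramifiedAE ρ :=
  isUnramifiedAE_of_isOpen_setOf_apply_eq_one ρ
    (Summit.BirchSwinnertonDyer.Rank1Residual.GaloisImage.SelmerFinite.isOpen_setOf_apply_eq_one ρ)

/-- **The finite set `S₀` of the Poitou–Tate files**: for a finite discrete `Γ_K`-module `M` and `n ≥ 1` there is a
finite set of places `S₀` containing every infinite place such that, at every finite place `v ∉ S₀`, `v ∤ n` and `M`
is unramified at `v` (the hypothesis `hS₀` of `PoitouTateShaAnnihilator.*`, `…MuRealShaDual*`, and the `S` of Milne I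
Thm. 4.10). [cite: SerreAbelianLadic1968, Ch. I §2.1] [cite: MilneADT2006, Ch. I §4, Thm. 4.10] -/
theorem exists_finset_place_isUnramifiedAt [Finite M] (ρ : DiscreteGaloisModule K M) (n : ℕ) [NeZero n] :
    ∃ S₀ : Finset (Place K), (∀ w : InfinitePlace K, (Sum.inl w : Place K) ∈ S₀) ∧
      ∀ v : HeightOneSpectrum (𝓞 K), (Sum.inr v : Place K) ∉ S₀ →
        ((n : ℕ) : 𝓞 K) ∉ v.asIdeal ∧ GaloisRep.IsUnramifiedAt v ρ := by
  classical
  obtain ⟨S, hSfin, hS⟩ := isUnramifiedAE_of_finite ρ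
  -- the finitely many places dividing `n`
  have hn0 : (Ideal.span {((n : ℕ) : 𝓞 K)} : Ideal (𝓞 K)) ≠ ⊥ := by
    rw [Ne, Ideal.span_singleton_eq_bot]
    exact_mod_cast NeZero.ne n
  have hTfin : {v : HeightOneSpectrum (𝓞 K) | ((n : ℕ) : 𝓞 K) ∈ v.asIdeal}.Finite := by
    refine (Ideal.finite_factors hn0).subset fun v hv => ?_
    simp only [Set.mem_setOf_eq] at hv ⊢
    rw [Ideal.dvd_span_singleton]
    exact hv
  refine ⟨(Finset.univ : Finset (InfinitePlace K)).map ⟨Sum.inl, Sum.inl_injective⟩ ∪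
      (hSfin.union hTfin).toFinset.map ⟨Sum.inr, Sum.inr_injective⟩, fun w => ?_, fun v hv => ?_⟩
  · exact Finset.mem_union_left _ (Finset.mem_map.2 ⟨w, Finset.mem_univ w, rfl⟩)
  · have hv' : v ∉ S ∪ {v : HeightOneSpectrum (𝓞 K) | ((n : ℕ) : 𝓞 K) ∈ v.asIdeal} := fun h =>
      hv (Finset.mem_union_right _ (Finset.mem_map.2 ⟨v, (Set.Finite.mem_toFinset _).2 h, rfl⟩))
    exact ⟨fun h => hv' (Or.inr h), hS v fun h => hv' (Or.inl h)⟩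

end Discrete

end Summit.BirchSwinnertonDyer.BirchSwinnertonDyer.Theorems.SignedEC.MuReal

end
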